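import Mathlib
import HarnessLib
import Summits.Ventures.LatticeQCDFlow.Scoring.IMHLiuSpectrum

/-!
# Where the spectrum of the exact flow-MCMC (IMH) chain lies: `{1} ∪ [0, 1 − 1/w⋆]`, and the top
# `1 − 1/w⋆` is attained — the tree's `L²` gap bound is an eigenvalue on every finite state space

HONEST FRAMING: exact (Metropolis-corrected) sampling algorithms for lattice gauge theory;
figures of merit are autocorrelation/cost numbers at stated couplings and volumes; no
continuum-physics claim.

Venture `LatticeQCDFlow` (cell pub-lqcd), topic `Scoring`; flow seat (`pub-lqcd-flow`, gen-24),
companion of `Scoring/IMHLiuSpectrum.lean` (Liu's eigenvalue theorem, finite form: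
`charpoly K = (X − 1) · ∏_{x ≠ ℓ} (X − G x x)`, `G x x = 1 − a x`).  NEW WORK of the cell
(elementary finite sums on the tree's objects `Scoring.liuG`, `Scoring.imhMatrix`; no definition
is added, nothing is cited as a tree fact).  Printed counterparts, named only as CONTEXT:
Liu 1996 Thm 2.1 (the eigenvalues `1 − a(x)`), Mengersen–Tweedie 1996 Thm 2.1 / Smith–Tierney 1996
(the independence sampler with `sup p/q = w⋆` has spectral gap `1/w⋆`) — the tree's own
general-state-space statements are `Exactness/FlowSamplerSpectralGap.lean` (`‖K g‖ ≤ (1 − W⁻¹)‖g‖`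
on mean-zero `g`, which lists 'lower bounds on the gap, the exact spectrum' under NOT CLAIMED) and
`Scoring/IMHAutocorrelationEnvelope.lean` (`|ρ_t| ≤ (1 − 1/w⋆)ᵗ`, sharp for the indicator of the
heaviest state).  This file closes that gap on FINITE state spaces: the rate is an eigenvalue.

## Content (target `p > 0`, model law `q > 0`; `w = p/q`; `h` a HEAVIEST state, `w x ≤ w h` for all
`x`, cross-multiplied `p x · q h ≤ p h · q x` — `exists_heaviest`)

* `one_sub_liuG_diag_of_heaviest` — at a heaviest state every proposal towards `z` is accepted
  with probability `w z / w h`, so `a h = 1 − G h h = (Σ_z p z) · q h / p h`;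
  `liuG_diag_of_heaviest` — for a normalised target, `G h h = 1 − 1/w⋆`, `w⋆ = p h / q h = max w`.
* `liuG_diag_nonneg`, `liuG_diag_le_of_heaviest` — with `Σ q = 1` every `G x x = 1 − a x` lies in
  `[0, G h h]`.
* **`imhMatrix_charpoly_eval_gap`** — `Σ p = 1`, a lightest state `ℓ` and a heaviest `h ≠ ℓ` (two
  weights differ): `charpoly K` vanishes at `1 − 1/w⋆` — the contraction factor `1 − W⁻¹` IS an
  eigenvalue of the exact flow-MCMC transition matrix, so no uniform rate better than the tree's
  bound exists on a finite state space.
* **`imhMatrix_charpoly_isRoot_imp`** — `Σ p = Σ q = 1`: every root of `charpoly K` (which splits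
  over `ℝ`, `imhMatrix_charpoly_roots`) is `1` or lies in `[0, 1 − 1/w⋆]`; in particular the
  spectrum is nonnegative (cf. `Scoring/IMHPositiveCorrelations.lean`).

NOT CLAIMED: anything on general (continuous) state spaces; eigenvectors; multiplicities beyond
what `IMHLiuSpectrum.imhMatrix_charpoly_roots` states; no number of any chain file is used.
-/

namespace Summit.Ventures.LatticeQCDFlow.Scoring

open Finset Literature.Probability.MarkovChains Summit.Ventures.LatticeQCDFlow.Exactness

variable {X : Type*} [Fintype X] [DecidableEq X]

omit [DecidableEq X] in
/-- A heaviest state exists: some `h` with `w x ≤ w h` for all `x` (cross-multiplied). -/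
theorem exists_heaviest [Nonempty X] (p q : X → ℝ) (hq : ∀ x, 0 < q x) :
    ∃ h, ∀ x, p x * q h ≤ p h * q x := by
  obtain ⟨h, -, hh⟩ := Finset.exists_max_image univ (fun x => p x / q x) univ_nonempty
  refine ⟨h, fun x => ?_⟩
  have h' : p x / q x ≤ p h / q h := hh x (mem_univ x)
  rwa [div_le_div_iff₀ (hq x) (hq h)] at h'

/-- At a HEAVIEST state `h` (`w x ≤ w h` for all `x`) every proposal towards `z` is accepted with
probability `w z / w h`, so `a h = 1 − G h h = (Σ_z p z) · q h / p h` — for a normalised target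
`a h = 1/w⋆`, `w⋆ = w h = max w`. -/
theorem one_sub_liuG_diag_of_heaviest {p q : X → ℝ} (hp : ∀ x, 0 < p x) {h : X}
    (hh : ∀ x, p x * q h ≤ p h * q x) :
    1 - liuG p q h h = (∑ z, p z) * q h / p h := by
  rw [one_sub_liuG_diag_eq_sum_min hp, Finset.sum_mul, Finset.sum_div]
  refine Finset.sum_congr rfl fun z _ => ?_
  apply min_eq_right
  rw [div_le_iff₀ (hp h)]
  linarith [hh z, mul_comm (q z) (p h)]

/-- Hence, for a normalised target (`Σ p = 1`), the top of Liu's diagonal is the Mengersen–Tweedie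
rate: `G h h = 1 − 1/w⋆` with `w⋆ = p h / q h` the largest importance weight. -/
theorem liuG_diag_of_heaviest {p q : X → ℝ} (hp : ∀ x, 0 < p x) (hp1 : ∑ x, p x = 1) {h : X}
    (hh : ∀ x, p x * q h ≤ p h * q x) : liuG p q h h = 1 - 1 / (p h / q h) := by
  have h1 := one_sub_liuG_diag_of_heaviest hp hh
  rw [hp1, one_mul] at h1
  rw [one_div_div]
  linarith

/-- Every diagonal entry `G x x = 1 − a x` is nonnegative when the model law is normalised
(`a x = Σ_z min (q z) (…) ≤ Σ_z q z = 1`). -/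
theorem liuG_diag_nonneg {p q : X → ℝ} (hp : ∀ x, 0 < p x) (hq1 : ∑ x, q x = 1) (x : X) :
    0 ≤ liuG p q x x := by
  have h1 : 1 - liuG p q x x = ∑ z, min (q z) (p z * q x / p x) :=
    one_sub_liuG_diag_eq_sum_min hp x
  have h2 : ∑ z, min (q z) (p z * q x / p x) ≤ ∑ z, q z :=
    Finset.sum_le_sum fun z _ => min_le_left _ _
  rw [hq1] at h2
  linarith

/-- … and none exceeds the heaviest state's: `G x x ≤ G h h` (`one_sub_liuG_diag_antitone`). -/
theorem liuG_diag_le_of_heaviest {p q : X → ℝ} (hp : ∀ x, 0 < p x) {h : X}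
    (hh : ∀ x, p x * q h ≤ p h * q x) (x : X) : liuG p q x x ≤ liuG p q h h := by
  have h1 := one_sub_liuG_diag_antitone hp (hh x)
  linarith

/-- **The tree's `L²` gap bound is attained on a finite state space.**  Normalised target, model
law `q > 0`, a lightest state `ℓ` and a heaviest state `h ≠ ℓ` (the weights are not all equal):
`1 − 1/w⋆` is a root of `charpoly K` — the contraction factor `1 − W⁻¹` of
`Exactness/FlowSamplerSpectralGap.lean` and the envelope rate of
`Scoring/IMHAutocorrelationEnvelope.lean` is an EIGENVALUE of the exact flow-MCMC transition matrix,
so no better uniform rate exists. -/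
theorem imhMatrix_charpoly_eval_gap {p q : X → ℝ} (hp : ∀ x, 0 < p x) (hp1 : ∑ x, p x = 1)
    (hq : ∀ x, 0 < q x) {ℓ h : X} (hℓ : ∀ x, p ℓ * q x ≤ p x * q ℓ)
    (hh : ∀ x, p x * q h ≤ p h * q x) (hne : h ≠ ℓ) :
    (imhMatrix p q).charpoly.eval (1 - 1 / (p h / q h)) = 0 := by
  rw [← liuG_diag_of_heaviest hp hp1 hh]
  exact imhMatrix_charpoly_eval_diag hp hq hℓ hne

/-- **Where the spectrum lies.**  Normalised target and model law, a lightest state `ℓ`, a heaviest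
state `h`: every (real) root of `charpoly K` — and `charpoly K` splits over `ℝ`
(`imhMatrix_charpoly_roots`) — is `1` or lies in `[0, 1 − 1/w⋆]`.  In particular the spectrum is
nonnegative (cf. `Scoring/IMHPositiveCorrelations.lean`) and the gap is exactly `1/w⋆` as soon as
two weights differ (`imhMatrix_charpoly_eval_gap`). -/
theorem imhMatrix_charpoly_isRoot_imp {p q : X → ℝ} (hp : ∀ x, 0 < p x) (hp1 : ∑ x, p x = 1)
    (hq : ∀ x, 0 < q x) (hq1 : ∑ x, q x = 1) {ℓ h : X} (hℓ : ∀ x, p ℓ * q x ≤ p x * q ℓ)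
    (hh : ∀ x, p x * q h ≤ p h * q x) {t : ℝ} (ht : (imhMatrix p q).charpoly.IsRoot t) :
    t = 1 ∨ (0 ≤ t ∧ t ≤ 1 - 1 / (p h / q h)) := by
  rw [Polynomial.IsRoot, imhMatrix_charpoly hp hq hℓ, Polynomial.eval_mul, mul_eq_zero] at ht
  rcases ht with h1 | h2
  · left
    have h1' : t - 1 = 0 := by simpa using h1
    linarith
  · right
    rw [Polynomial.eval_prod, Finset.prod_eq_zero_iff] at h2
    obtain ⟨x, -, hx0⟩ := h2
    have hx : t = liuG p q x x := by
      have h' : t - liuG p q x x = 0 := by simpa using hx0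
      linarith
    rw [hx, ← liuG_diag_of_heaviest hp hp1 hh]
    exact ⟨liuG_diag_nonneg hp hq1 x, liuG_diag_le_of_heaviest hp hh x⟩

end Summit.Ventures.LatticeQCDFlow.Scoring
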